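import Summits.CriticalPhenomena.Ising3DConformalLimit.Theses.CoerciveSharpness
import Literature.Probability.LatticeModels.PointwiseScalingLimitEtaExists
import Literature.Probability.LatticeModels.IsingExponentsProofs
import Literature.Probability.LatticeModels.SharpnessProofs
import HarnessLib

/-!
# Crux `DimensionPinned` (stmt-CriticalPhenomena-4662) — the certified implication web of the
# STRATEGY CENSUS (crux-strategist workfile, sorry-free, no stubs)

The crux, verbatim: `DimensionPinned := ∃ η : ℝ, HasIsingEtaBounds 3 η`, i.e. two-sided PURE-POWER
bounds `c‖x‖^{-(1+η)} ≤ ⟨σ₀σ_x⟩_{β_c(3)} ≤ C‖x‖^{-(1+η)}` for all `x ≠ 0` on `ℤ³` (sup norm).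

This file proves, over the tree only (`criticalTwoPoint_axis_antitone/_pos/_sandwich`,
`criticalTwoPoint_bounds_holds`, `HasIsingEtaBounds.hasIsingExponentEta'`), the web of implications
the census relies on.  With `g n := ⟨σ₀σ_{n e₀}⟩_{β_c(3)}`:

* `dimensionPinned_iff_axisPinned`     : crux ⟺ `AxisPinned` (two-sided power bounds along ONE axis;
  Messager–Miracle-Solé sphere sandwich does the angles — no isotropy is needed for BOUNDS);
* `axisPinned_iff_dyadicPinned`         : ⟺ the same along `n = 2^k` only (MMS antitonicity fills in);
* `dimensionPinned_iff_scaleMult`       : crux ⟺ `ScaleSubmult ∧ ScaleSupermult`, the two halves of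
  two-sided QUASI-MULTIPLICATIVITY IN THE SCALE VARIABLE, `g(mn)·g(1) ≍ g(m)·g(n)` — the census's best
  typed 2-piece split, glued by a multiplicative Fekete lemma (`linear_bounds_of_almost_additive`);
* `dimensionPinned_of_dyadicDiniLaw`    : the REGISTERED stub S1 `DyadicDiniLaw` of the sibling crux
  0634's line `dyadic_dini_isotropy` (summable Wegner rate of the dyadic ratio) ALONE implies the crux;
* `dimensionPinned_of_rotInvPowerLaw`   : item 0634 (`IsingEuclidUpgradeR2RotInvPowerLaw`) implies the crux;
* `twoPointDoubling_of_dimensionPinned` : the crux implies item 6150 `TwoPointDoubling` (verbatim);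
* `etaExists_of_dimensionPinned`        : the crux implies item 0635 (`∃ η, HasIsingExponentEta 3 η`).

So in the ledger's lattice of two-point statements: S1(0634-line) ⟹ 4662, 0634 ⟹ 4662, 4662 ⟹ 6150,
4662 ⟹ 0635; and 4662 is EQUIVALENT to a pair of exponent-free correlation inequalities (QM⁺, QM⁻),
each of which alone already forces existence of the dyadic axis exponent (one-sided Fekete,
`lower_envelope_of_scaleSubmult`, `upper_envelope_of_scaleSupermult`).

References: Aizenman–Duminil-Copin, Ann. Math. 194 (2021), arXiv:1912.07973, Remark 5.10 and §5.6
p. 20; Duminil-Copin–Panis, CMP 406 (2025), arXiv:2404.05700, Thms 1.4, 1.5, 1.8; Fekete's lemma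
(Mathlib `Subadditive`).
-/

noncomputable section

namespace Summit.CriticalPhenomena.Ising3DConformalLimit.Cruxes.DimensionPinned.CensusWeb

open Filter Topology Literature.Probability.LatticeModels
open Summit.CriticalPhenomena.Ising3DConformalLimit.Theses.CoerciveSharpness (DimensionPinned)

/-! ## The axis two-point function and its tree API -/

/-- The critical axis two-point function `g n = ⟨σ₀σ_{n e₀}⟩_{β_c(3)}`. -/
def g (n : ℕ) : ℝ := criticalTwoPoint 3 (Pi.single 0 (n : ℤ))

theorem g_def (n : ℕ) : g n = criticalTwoPoint 3 (Pi.single 0 (n : ℤ)) := rfl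

theorem g_pos (n : ℕ) : 0 < g n := criticalTwoPoint_axis_pos n

theorem g_antitone : Antitone g := fun _ _ h => criticalTwoPoint_axis_antitone h

theorem g_le_one (n : ℕ) : g n ≤ 1 := criticalTwoPoint_le_one' _

theorem norm_axis (n : ℕ) : ‖(Pi.single 0 (n : ℤ) : Site 3)‖ = n := by
  rw [Pi.norm_single, Int.norm_eq_abs]
  push_cast
  exact abs_of_nonneg (Nat.cast_nonneg n)

theorem axis_ne_zero {n : ℕ} (hn : 1 ≤ n) : (Pi.single 0 (n : ℤ) : Site 3) ≠ 0 := by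
  intro h
  have h0 := congrFun h 0
  simp at h0
  omega

/-- A priori Simon–Lieb floor along the axis: `g n ≥ c₀ n⁻²` (tree `criticalTwoPoint_bounds_holds`). -/
theorem g_floor : ∃ c₀ : ℝ, 0 < c₀ ∧ ∀ n : ℕ, 1 ≤ n → c₀ * (n : ℝ) ^ (-(2 : ℝ)) ≤ g n := by
  obtain ⟨c, C, hc, hb⟩ := criticalTwoPoint_bounds_holds (d := 3) le_rfl
  refine ⟨c, hc, fun n hn => ?_⟩
  have h := (hb (Pi.single 0 (n : ℤ)) (axis_ne_zero hn)).1
  rw [norm_axis] at h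
  have e : (-(((3 : ℕ) : ℝ) - 1)) = (-(2 : ℝ)) := by norm_num
  rw [e] at h
  exact h

/-! ## The statements of the web -/

/-- Two-sided pure-power bounds along the first axis. -/
def AxisPinned : Prop :=
  ∃ s c C : ℝ, 0 < c ∧ ∀ n : ℕ, 1 ≤ n → c * (n : ℝ) ^ (-s) ≤ g n ∧ g n ≤ C * (n : ℝ) ^ (-s)

/-- Two-sided pure-power bounds along the dyadic axis scales `n = 2^k`. -/
def DyadicPinned : Prop :=
  ∃ s c C : ℝ, 0 < c ∧ ∀ k : ℕ, c * ((2 : ℝ) ^ k) ^ (-s) ≤ g (2 ^ k) ∧ g (2 ^ k) ≤ C * ((2 : ℝ) ^ k) ^ (-s)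

/-- QM⁺ (sub-multiplicativity in the scale variable): `g(mn)·g(1) ≤ K·g(m)·g(n)`. -/
def ScaleSubmult : Prop :=
  ∃ K : ℝ, ∀ m n : ℕ, 1 ≤ m → 1 ≤ n → g (m * n) * g 1 ≤ K * (g m * g n)

/-- QM⁻ (super-multiplicativity in the scale variable): `g(m)·g(n) ≤ K·g(mn)·g(1)`. -/
def ScaleSupermult : Prop :=
  ∃ K : ℝ, ∀ m n : ℕ, 1 ≤ m → 1 ≤ n → g m * g n ≤ K * (g (m * n) * g 1)

/-- S1 of the sibling line `Cruxes/IsingEuclidUpgradeR2RotInvPowerLaw/Lines/dyadic_dini_isotropy.lean`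
(registered stub `stub_dyadicDiniLaw` of item 0634), statement VERBATIM. -/
def DyadicDiniLaw : Prop :=
  ∃ Δ ω C : ℝ, 0 < ω ∧ ∀ n : ℕ, 1 ≤ n → |Literature.Probability.LatticeModels.criticalTwoPoint 3 (Pi.single 0 ((2 * n : ℕ) : ℤ)) * (4 : ℝ) ^ Δ / Literature.Probability.LatticeModels.criticalTwoPoint 3 (Pi.single 0 ((n : ℕ) : ℤ)) - 1| ≤ C * (n : ℝ) ^ (-ω)

/-- Item stmt-CriticalPhenomena-0634 (`IsingEuclidUpgradeR2RotInvPowerLaw`), signature VERBATIM. -/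
def RotInvPowerLaw : Prop :=
  ∃ Δ c : ℝ, 0 < c ∧ Filter.Tendsto (fun x : Literature.Probability.LatticeModels.Site 3 => Literature.Probability.LatticeModels.criticalTwoPoint 3 x * Real.sqrt (∑ i, ((x i : ℝ)) ^ 2) ^ (2 * Δ)) Filter.cofinite (nhds c)

/-- Item stmt-CriticalPhenomena-6150 (`MirrorHoelderCompactness.TwoPointDoubling`), signature VERBATIM. -/
def TwoPointDoubling : Prop :=
  ∃ κ : ℝ, 0 < κ ∧ ∀ n : ℕ, 1 ≤ n → κ * Literature.Probability.LatticeModels.criticalTwoPoint 3 (Pi.single 0 (n : ℤ)) ≤ Literature.Probability.LatticeModels.criticalTwoPoint 3 (Pi.single 0 (2 * (n : ℤ)))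

/-- Item stmt-CriticalPhenomena-0635 (`IsingEuclidUpgrade_r3_etaExists`), signature VERBATIM. -/
def EtaExists : Prop :=
  ∃ η : ℝ, Literature.Probability.LatticeModels.HasIsingExponentEta 3 η

/-- Census §Strengthen, candidate S⁺_spec (typed only; NOT used below): two-sided power mass at the
EDGE of the axis Källén–Lehmann measure (the data of the PROVED item 6328 `AxisKallenLehmann`,
`g n = ∫ tⁿ dν`, `ν ≥ 0` on `[0,1]`), `ν([1−ε,1]) ≍ ε^s`. Equivalent to `AxisPinned` by an elementary
Abelian/Tauberian sandwich for positive measures (census §Strengthen 3); recorded, not registered. -/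
def SpectralEdgePinned : Prop :=
  ∃ ν : MeasureTheory.Measure ℝ, MeasureTheory.IsFiniteMeasure ν ∧ ν (Set.Icc (0 : ℝ) 1)ᶜ = 0 ∧
    (∀ n : ℕ, Literature.Probability.LatticeModels.criticalTwoPoint 3 (Pi.single 0 ((n : ℕ) : ℤ)) = ∫ t, t ^ n ∂ν) ∧
    ∃ s c C : ℝ, 0 < c ∧ ∀ ε : ℝ, 0 < ε → ε ≤ 1 →
      c * ε ^ s ≤ (ν (Set.Icc (1 - ε) 1)).toReal ∧ (ν (Set.Icc (1 - ε) 1)).toReal ≤ C * ε ^ s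

/-- Census §Decomposition, the rejected "trivial-seam" split (typed only; NOT used below): the two
ENVELOPE halves around the intrinsic liminf/limsup rates. -/
def LowerEnvelope : Prop :=
  ∃ c : ℝ, 0 < c ∧ ∀ n : ℕ, 1 ≤ n →
    c * (n : ℝ) ^ (-(Filter.liminf (fun m : ℕ => -Real.log (g m) / Real.log m) Filter.atTop)) ≤ g n

/-- See `LowerEnvelope`. -/
def UpperEnvelope : Prop :=
  ∃ C : ℝ, ∀ n : ℕ, 1 ≤ n →
    g n ≤ C * (n : ℝ) ^ (-(Filter.limsup (fun m : ℕ => -Real.log (g m) / Real.log m) Filter.atTop))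

/-! ## crux ⟺ AxisPinned (Messager–Miracle-Solé sandwich; no isotropy needed for bounds) -/

theorem axisPinned_of_dimensionPinned (h : DimensionPinned) : AxisPinned := by
  obtain ⟨η, c, C, hc, hb⟩ := h
  refine ⟨((3 : ℕ) : ℝ) - 2 + η, c, C, hc, fun n hn => ?_⟩
  have hx := hb (Pi.single 0 (n : ℤ)) (axis_ne_zero hn)
  rw [norm_axis] at hx
  exact hx

theorem dimensionPinned_of_axisPinned (h : AxisPinned) : DimensionPinned := by
  obtain ⟨s, c, C, hc, hb⟩ := h
  refine ⟨s - (((3 : ℕ) : ℝ) - 2), c * (3 : ℝ) ^ (-s), C, by positivity, fun x hx => ?_⟩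
  have hexp : ((3 : ℕ) : ℝ) - 2 + (s - (((3 : ℕ) : ℝ) - 2)) = s := by ring
  rw [hexp]
  set n := Site.supNorm x with hn
  have hn1 : 1 ≤ n := Nat.one_le_iff_ne_zero.2 fun h0 => hx (Site.supNorm_eq_zero_iff.1 h0)
  have hnorm : ‖x‖ = (n : ℝ) := Site.norm_eq_supNorm x
  obtain ⟨hlo, hhi⟩ := criticalTwoPoint_axis_sandwich (y := x) hn1
  have h3n := (hb (3 * n) (by omega)).1
  have hn' := (hb n hn1).2
  rw [hnorm]
  constructor
  · calc c * (3 : ℝ) ^ (-s) * ((n : ℝ)) ^ (-s) = c * (((3 * n : ℕ) : ℝ)) ^ (-s) := by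
          rw [Nat.cast_mul, Nat.cast_ofNat, Real.mul_rpow (by norm_num) (Nat.cast_nonneg n)]
          ring
      _ ≤ g (3 * n) := h3n
      _ ≤ criticalTwoPoint 3 x := hlo
  · calc criticalTwoPoint 3 x ≤ g n := hhi
      _ ≤ C * (n : ℝ) ^ (-s) := hn'

/-- **crux ⟺ AxisPinned.** -/
theorem dimensionPinned_iff_axisPinned : DimensionPinned ↔ AxisPinned :=
  ⟨axisPinned_of_dimensionPinned, dimensionPinned_of_axisPinned⟩

/-! ## AxisPinned ⟺ DyadicPinned (antitonicity fills in between dyadic scales) -/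

theorem dyadicPinned_of_axisPinned (h : AxisPinned) : DyadicPinned := by
  obtain ⟨s, c, C, hc, hb⟩ := h
  refine ⟨s, c, C, hc, fun k => ?_⟩
  have h1 := hb (2 ^ k) Nat.one_le_two_pow
  push_cast at h1
  exact h1

theorem axisPinned_of_dyadicPinned (h : DyadicPinned) : AxisPinned := by
  obtain ⟨s, c, C, hc, hb⟩ := h
  -- the exponent is nonnegative (else the lower bound would exceed `g ≤ 1`)
  have hs : 0 ≤ s := by
    by_contra hs
    push Not at hs
    have h1 : Tendsto (fun k : ℕ => ((2 : ℝ) ^ (-s)) ^ k) atTop atTop :=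
      tendsto_pow_atTop_atTop_of_one_lt (Real.one_lt_rpow one_lt_two (by linarith))
    have h2 : Tendsto (fun k : ℕ => c * ((2 : ℝ) ^ (-s)) ^ k) atTop atTop :=
      Tendsto.const_mul_atTop hc h1
    obtain ⟨k, hk⟩ := (h2.eventually_gt_atTop 1).exists
    have h3 : c * ((2 : ℝ) ^ (-s)) ^ k ≤ 1 := by
      have h4 := (hb k).1.trans (g_le_one _)
      have e : ((2 : ℝ) ^ k) ^ (-s) = ((2 : ℝ) ^ (-s)) ^ k := by
        rw [← Real.rpow_natCast ((2 : ℝ) ^ (-s)) k, ← Real.rpow_mul (by norm_num : (0 : ℝ) ≤ 2),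
          mul_comm, Real.rpow_mul (by norm_num : (0 : ℝ) ≤ 2), Real.rpow_natCast]
      rw [e] at h4
      exact h4
    linarith
  have hC : 0 ≤ C := by
    have h0 := (g_pos (2 ^ 0)).trans_le (hb 0).2
    simp at h0
    exact h0.le
  refine ⟨s, c * (2 : ℝ) ^ (-s), C * (2 : ℝ) ^ s, by positivity, fun n hn => ?_⟩
  set k := Nat.log 2 n with hk
  have h1 : 2 ^ k ≤ n := Nat.pow_log_le_self 2 (by omega)
  have h2 : n < 2 ^ (k + 1) := Nat.lt_pow_succ_log_self (by norm_num) n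
  have hgn_lo : g (2 ^ (k + 1)) ≤ g n := g_antitone h2.le
  have hgn_hi : g n ≤ g (2 ^ k) := g_antitone h1
  have hnpos : (0 : ℝ) < n := by exact_mod_cast (show 0 < n by omega)
  have h2k : (0 : ℝ) < (2 : ℝ) ^ k := by positivity
  have h2s : (0 : ℝ) < (2 : ℝ) ^ s := by positivity
  constructor
  · have hcmp : ((n : ℝ)) ^ (-s) ≤ ((2 : ℝ) ^ k) ^ (-s) :=
      Real.rpow_le_rpow_of_nonpos h2k (by exact_mod_cast h1) (neg_nonpos.2 hs)
    calc c * (2 : ℝ) ^ (-s) * (n : ℝ) ^ (-s) ≤ c * (2 : ℝ) ^ (-s) * ((2 : ℝ) ^ k) ^ (-s) := by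
          apply mul_le_mul_of_nonneg_left hcmp
          positivity
      _ = c * ((2 : ℝ) ^ (k + 1)) ^ (-s) := by
          rw [pow_succ, Real.mul_rpow h2k.le (by norm_num)]
          ring
      _ ≤ g (2 ^ (k + 1)) := (hb (k + 1)).1
      _ ≤ g n := hgn_lo
  · have hcmp : ((2 : ℝ) ^ (k + 1)) ^ (-s) ≤ ((n : ℝ)) ^ (-s) :=
      Real.rpow_le_rpow_of_nonpos hnpos (by exact_mod_cast h2.le) (neg_nonpos.2 hs)
    calc g n ≤ g (2 ^ k) := hgn_hi
      _ ≤ C * ((2 : ℝ) ^ k) ^ (-s) := (hb k).2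
      _ = C * (2 : ℝ) ^ s * ((2 : ℝ) ^ (k + 1)) ^ (-s) := by
          rw [pow_succ, Real.mul_rpow h2k.le (by norm_num), Real.rpow_neg (by norm_num : (0 : ℝ) ≤ 2) s]
          field_simp
      _ ≤ C * (2 : ℝ) ^ s * (n : ℝ) ^ (-s) := by
          apply mul_le_mul_of_nonneg_left hcmp
          positivity

/-- **AxisPinned ⟺ DyadicPinned.** -/
theorem axisPinned_iff_dyadicPinned : AxisPinned ↔ DyadicPinned :=
  ⟨dyadicPinned_of_axisPinned, axisPinned_of_dyadicPinned⟩

/-- From two-sided bounds on `log g(2^k) + s·k·log 2` to `DyadicPinned` with exponent `s`. -/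
theorem dyadicPinned_of_log_linear {s B₁ B₂ : ℝ}
    (h : ∀ k : ℕ, B₁ ≤ Real.log (g (2 ^ k)) + s * k * Real.log 2 ∧
      Real.log (g (2 ^ k)) + s * k * Real.log 2 ≤ B₂) :
    DyadicPinned := by
  refine ⟨s, Real.exp B₁, Real.exp B₂, Real.exp_pos _, fun k => ?_⟩
  have h2k : (0 : ℝ) < (2 : ℝ) ^ k := by positivity
  have hrpow : ((2 : ℝ) ^ k) ^ (-s) = Real.exp (-(s * k * Real.log 2)) := by
    rw [Real.rpow_def_of_pos h2k, Real.log_pow]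
    congr 1
    ring
  have hg : g (2 ^ k) = Real.exp (Real.log (g (2 ^ k))) := (Real.exp_log (g_pos _)).symm
  obtain ⟨h1, h2⟩ := h k
  rw [hrpow, hg, ← Real.exp_add, ← Real.exp_add, Real.exp_le_exp, Real.exp_le_exp]
  constructor <;> linarith

/-! ## The multiplicative Fekete lemma and crux ⟺ QM⁺ ∧ QM⁻ -/

/-- **Fekete, two-sided, up to an additive constant.** If `u : ℕ → ℝ` is both sub- and
super-additive up to `L`, and a priori squeezed between two affine functions, then `u` is affine up
to `L`: `σk − L ≤ u k ≤ σk + L` with `σ = lim u(k)/k`. [folklore: Fekete's lemma] -/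
theorem linear_bounds_of_almost_additive {u : ℕ → ℝ} {L a a' A A' : ℝ}
    (hsub : ∀ j k, u (j + k) ≤ u j + u k + L) (hsup : ∀ j k, u j + u k ≤ u (j + k) + L)
    (hlo : ∀ k : ℕ, a * k - A ≤ u k) (hhi : ∀ k : ℕ, u k ≤ a' * k + A') :
    ∃ σ : ℝ, ∀ k : ℕ, σ * k - L ≤ u k ∧ u k ≤ σ * k + L := by
  -- `v := u + L` is subadditive, `w := L - u` is subadditive
  set v : ℕ → ℝ := fun k => u k + L with hv
  set w : ℕ → ℝ := fun k => L - u k with hw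
  have hvsub : Subadditive v := by
    intro m n
    simp only [hv]
    linarith [hsub m n]
  have hwsub : Subadditive w := by
    intro m n
    simp only [hw]
    linarith [hsup m n]
  have hvbdd : BddBelow (Set.range fun n => v n / n) := by
    refine ⟨min 0 (a - |A - L|), ?_⟩
    rintro _ ⟨n, rfl⟩
    rcases Nat.eq_zero_or_pos n with h0 | hpos
    · subst h0
      simp
    · have hn : (1 : ℝ) ≤ n := by exact_mod_cast hpos
      have hnpos : (0 : ℝ) < n := by linarith
      show min 0 (a - |A - L|) ≤ v n / n
      rw [le_div_iff₀ hnpos]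
      have habs := le_abs_self (A - L)
      have habs0 := abs_nonneg (A - L)
      calc min 0 (a - |A - L|) * n ≤ (a - |A - L|) * n :=
            mul_le_mul_of_nonneg_right (min_le_right _ _) hnpos.le
        _ = a * n - |A - L| * n := by ring
        _ ≤ a * n - |A - L| := by nlinarith
        _ ≤ v n := by simp only [hv]; linarith [hlo n]
  have hwbdd : BddBelow (Set.range fun n => w n / n) := by
    refine ⟨min 0 (-a' - |A' - L|), ?_⟩
    rintro _ ⟨n, rfl⟩
    rcases Nat.eq_zero_or_pos n with h0 | hpos
    · subst h0
      simp
    · have hn : (1 : ℝ) ≤ n := by exact_mod_cast hpos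
      have hnpos : (0 : ℝ) < n := by linarith
      show min 0 (-a' - |A' - L|) ≤ w n / n
      rw [le_div_iff₀ hnpos]
      have habs := le_abs_self (A' - L)
      have habs0 := abs_nonneg (A' - L)
      calc min 0 (-a' - |A' - L|) * n ≤ (-a' - |A' - L|) * n :=
            mul_le_mul_of_nonneg_right (min_le_right _ _) hnpos.le
        _ = -a' * n - |A' - L| * n := by ring
        _ ≤ -a' * n - |A' - L| := by nlinarith
        _ ≤ w n := by simp only [hw]; linarith [hhi n]
  have hvlim := hvsub.tendsto_lim hvbdd
  have hwlim := hwsub.tendsto_lim hwbdd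
  -- the two limits are opposite: `v n / n + w n / n = 2L/n → 0`
  have hsum : Tendsto (fun n : ℕ => v n / n + w n / n) atTop (𝓝 0) := by
    have h2L := tendsto_const_div_atTop_nhds_zero_nat (2 * L)
    refine h2L.congr' ?_
    filter_upwards [eventually_ge_atTop 1] with n hn
    simp only [hv, hw]
    rw [← add_div]
    congr 1
    ring
  have hlims : hvsub.lim + hwsub.lim = 0 := tendsto_nhds_unique (hvlim.add hwlim) hsum
  refine ⟨hvsub.lim, fun k => ?_⟩
  rcases Nat.eq_zero_or_pos k with h0 | hpos
  · subst h0
    have h1 := hsub 0 0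
    have h2 := hsup 0 0
    simp only [add_zero] at h1 h2
    constructor <;> simp <;> linarith
  · have hk : (0 : ℝ) < k := by exact_mod_cast hpos
    have hk0 : k ≠ 0 := by omega
    have h1 := hvsub.lim_le_div hvbdd hk0
    have h2 := hwsub.lim_le_div hwbdd hk0
    simp only [hv, hw] at h1 h2
    rw [le_div_iff₀ hk] at h1 h2
    constructor
    · linarith
    · have : hwsub.lim = -hvsub.lim := by linarith
      rw [this] at h2
      linarith

/-- **QM⁺ ∧ QM⁻ ⟹ DyadicPinned** (multiplicative Fekete on `u k := log g(1) − log g(2^k)`, with the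
a priori window `c₀4^{-k} ≤ g(2^k) ≤ 1`). -/
theorem dyadicPinned_of_scaleMult (h₁ : ScaleSubmult) (h₂ : ScaleSupermult) : DyadicPinned := by
  obtain ⟨K₁, hK₁⟩ := h₁
  obtain ⟨K₂, hK₂⟩ := h₂
  have hg1 := g_pos 1
  have hK₁1 : 1 ≤ K₁ := by
    have h := hK₁ 1 1 le_rfl le_rfl
    simp only [mul_one] at h
    exact le_of_mul_le_mul_right (by linarith) (mul_pos hg1 hg1)
  have hK₂1 : 1 ≤ K₂ := by
    have h := hK₂ 1 1 le_rfl le_rfl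
    simp only [mul_one] at h
    exact le_of_mul_le_mul_right (by linarith) (mul_pos hg1 hg1)
  have hK₁pos : 0 < K₁ := by linarith
  have hK₂pos : 0 < K₂ := by linarith
  set L : ℝ := max (Real.log K₁) (Real.log K₂) with hL
  set u : ℕ → ℝ := fun k => Real.log (g 1) - Real.log (g (2 ^ k)) with hu
  -- sub-additivity up to `L` from QM⁻, super-additivity up to `L` from QM⁺
  have hsub : ∀ j k, u (j + k) ≤ u j + u k + L := by
    intro j k
    have h := hK₂ (2 ^ j) (2 ^ k) Nat.one_le_two_pow Nat.one_le_two_pow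
    rw [← pow_add] at h
    have hp1 := g_pos (2 ^ j)
    have hp2 := g_pos (2 ^ k)
    have hp3 := g_pos (2 ^ (j + k))
    have hlog := Real.log_le_log (mul_pos hp1 hp2) h
    rw [Real.log_mul hp1.ne' hp2.ne', Real.log_mul hK₂pos.ne' (mul_pos hp3 hg1).ne',
      Real.log_mul hp3.ne' hg1.ne'] at hlog
    have hL2 : Real.log K₂ ≤ L := le_max_right _ _
    simp only [hu]
    linarith
  have hsup : ∀ j k, u j + u k ≤ u (j + k) + L := by
    intro j k
    have h := hK₁ (2 ^ j) (2 ^ k) Nat.one_le_two_pow Nat.one_le_two_pow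
    rw [← pow_add] at h
    have hp1 := g_pos (2 ^ j)
    have hp2 := g_pos (2 ^ k)
    have hp3 := g_pos (2 ^ (j + k))
    have hlog := Real.log_le_log (mul_pos hp3 hg1) h
    rw [Real.log_mul hp3.ne' hg1.ne', Real.log_mul hK₁pos.ne' (mul_pos hp1 hp2).ne',
      Real.log_mul hp1.ne' hp2.ne'] at hlog
    have hL1 : Real.log K₁ ≤ L := le_max_left _ _
    simp only [hu]
    linarith
  -- a priori affine bounds: `g ≤ 1` and the Simon–Lieb floor `g(2^k) ≥ c₀ 4^{-k}`
  obtain ⟨c₀, hc₀, hfloor⟩ := g_floor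
  have hlo : ∀ k : ℕ, (0 : ℝ) * k - (-Real.log (g 1)) ≤ u k := by
    intro k
    have h := Real.log_le_log (g_pos (2 ^ k)) (g_le_one (2 ^ k))
    rw [Real.log_one] at h
    simp only [hu]
    linarith
  have hhi : ∀ k : ℕ, u k ≤ (2 * Real.log 2) * k + (Real.log (g 1) - Real.log c₀ + (-Real.log (g 1)) ⊔ 0) := by
    intro k
    have h := hfloor (2 ^ k) Nat.one_le_two_pow
    have h2k : (0 : ℝ) < (2 : ℝ) ^ k := by positivity
    have hrp : (((2 ^ k : ℕ) : ℝ)) ^ (-(2 : ℝ)) = Real.exp (-(2 * Real.log 2 * k)) := by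
      push_cast
      rw [Real.rpow_def_of_pos h2k, Real.log_pow]
      congr 1
      ring
    rw [hrp] at h
    have hlog := Real.log_le_log (mul_pos hc₀ (Real.exp_pos _)) h
    rw [Real.log_mul hc₀.ne' (Real.exp_pos _).ne', Real.log_exp] at hlog
    have hmax : (0 : ℝ) ≤ (-Real.log (g 1)) ⊔ 0 := le_max_right _ _
    simp only [hu]
    linarith
  obtain ⟨σ, hσ⟩ := linear_bounds_of_almost_additive hsub hsup hlo hhi
  -- unpack: `log g(2^k) + σ k ∈ [log g 1 - L, log g 1 + L]`
  have hlog2 : 0 < Real.log 2 := Real.log_pos one_lt_two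
  refine dyadicPinned_of_log_linear (s := σ / Real.log 2) (B₁ := Real.log (g 1) - L)
    (B₂ := Real.log (g 1) + L) fun k => ?_
  have e : σ / Real.log 2 * k * Real.log 2 = σ * k := by
    field_simp
  rw [e]
  obtain ⟨h1, h2⟩ := hσ k
  simp only [hu] at h1 h2
  constructor <;> linarith

/-- **AxisPinned ⟹ QM⁺ ∧ QM⁻** (the trivial direction). -/
theorem scaleMult_of_axisPinned (h : AxisPinned) : ScaleSubmult ∧ ScaleSupermult := by
  obtain ⟨s, c, C, hc, hb⟩ := h
  have hg1 := g_pos 1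
  have hcC : c ≤ C := by
    have h1 := hb 1 le_rfl
    simp at h1
    linarith [h1.1, h1.2]
  have hC : 0 < C := lt_of_lt_of_le hc hcC
  have hmul : ∀ m n : ℕ, 1 ≤ m → 1 ≤ n →
      (((m * n : ℕ) : ℝ)) ^ (-s) = ((m : ℝ)) ^ (-s) * ((n : ℝ)) ^ (-s) := by
    intro m n _ _
    rw [Nat.cast_mul, Real.mul_rpow (Nat.cast_nonneg m) (Nat.cast_nonneg n)]
  constructor
  · refine ⟨C / c ^ 2, fun m n hm hn => ?_⟩
    have hmn : 1 ≤ m * n := Nat.one_le_iff_ne_zero.2 (Nat.mul_ne_zero (by omega) (by omega))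
    have h1 := (hb (m * n) hmn).2
    have h2 := (hb m hm).1
    have h3 := (hb n hn).1
    have hmpos : (0 : ℝ) < (m : ℝ) ^ (-s) := Real.rpow_pos_of_pos (by exact_mod_cast (show 0 < m by omega)) _
    have hnpos : (0 : ℝ) < (n : ℝ) ^ (-s) := Real.rpow_pos_of_pos (by exact_mod_cast (show 0 < n by omega)) _
    rw [hmul m n hm hn] at h1
    -- `m^{-s} ≤ g m / c`, `n^{-s} ≤ g n / c`
    have h2' : (m : ℝ) ^ (-s) ≤ g m / c := by rw [le_div_iff₀ hc]; linarith
    have h3' : (n : ℝ) ^ (-s) ≤ g n / c := by rw [le_div_iff₀ hc]; linarith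
    calc g (m * n) * g 1 ≤ C * ((m : ℝ) ^ (-s) * (n : ℝ) ^ (-s)) * 1 :=
          mul_le_mul h1 (g_le_one 1) hg1.le (by positivity)
      _ ≤ C * (g m / c * (g n / c)) * 1 := by
          have := mul_le_mul h2' h3' hnpos.le (div_nonneg (g_pos m).le hc.le)
          nlinarith
      _ = C / c ^ 2 * (g m * g n) := by
          field_simp
  · refine ⟨C ^ 2 / (c * g 1), fun m n hm hn => ?_⟩
    have hmn : 1 ≤ m * n := Nat.one_le_iff_ne_zero.2 (Nat.mul_ne_zero (by omega) (by omega))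
    have h1 := (hb (m * n) hmn).1
    have h2 := (hb m hm).2
    have h3 := (hb n hn).2
    have hmpos : (0 : ℝ) < (m : ℝ) ^ (-s) := Real.rpow_pos_of_pos (by exact_mod_cast (show 0 < m by omega)) _
    have hnpos : (0 : ℝ) < (n : ℝ) ^ (-s) := Real.rpow_pos_of_pos (by exact_mod_cast (show 0 < n by omega)) _
    rw [hmul m n hm hn] at h1
    have h1' : (m : ℝ) ^ (-s) * (n : ℝ) ^ (-s) ≤ g (m * n) / c := by rw [le_div_iff₀ hc]; linarith
    calc g m * g n ≤ (C * (m : ℝ) ^ (-s)) * (C * (n : ℝ) ^ (-s)) :=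
          mul_le_mul h2 h3 (g_pos n).le (by positivity)
      _ = C ^ 2 * ((m : ℝ) ^ (-s) * (n : ℝ) ^ (-s)) := by ring
      _ ≤ C ^ 2 * (g (m * n) / c) := mul_le_mul_of_nonneg_left h1' (by positivity)
      _ = C ^ 2 / (c * g 1) * (g (m * n) * g 1) := by
          field_simp

/-- **crux ⟺ QM⁺ ∧ QM⁻** (the census's best typed two-piece split; lossless). -/
theorem dimensionPinned_iff_scaleMult : DimensionPinned ↔ ScaleSubmult ∧ ScaleSupermult := by
  constructor
  · intro h
    exact scaleMult_of_axisPinned (axisPinned_of_dimensionPinned h)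
  · rintro ⟨h₁, h₂⟩
    exact dimensionPinned_of_axisPinned (axisPinned_of_dyadicPinned (dyadicPinned_of_scaleMult h₁ h₂))

/-- The glue in the shape the protocol asks for: `Sub₁ → Sub₂ → crux`. -/
theorem DimensionPinned_of_subs (h₁ : ScaleSubmult) (h₂ : ScaleSupermult) : DimensionPinned :=
  dimensionPinned_iff_scaleMult.2 ⟨h₁, h₂⟩

/-! ## One-sided Fekete: each QM half alone already forces the (dyadic, axial) exponent to exist,
together with ONE envelope -/

/-- **QM⁺ alone ⟹ lower envelope + existence of the dyadic exponent**: there is `σ` with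
`u(k)/k → σ` and `g(2^k) ≥ g(1)e^{-L}e^{-σ k}` for all `k`, where `u k = log g 1 − log g(2^k)`. -/
theorem lower_envelope_of_scaleSubmult (h : ScaleSubmult) :
    ∃ σ L : ℝ, Tendsto (fun k : ℕ => (Real.log (g 1) - Real.log (g (2 ^ k))) / k) atTop (𝓝 σ) ∧
      ∀ k : ℕ, Real.log (g 1) - Real.log (g (2 ^ k)) ≤ σ * k + L := by
  obtain ⟨K₁, hK₁⟩ := h
  have hg1 := g_pos 1
  have hK₁1 : 1 ≤ K₁ := by
    have h := hK₁ 1 1 le_rfl le_rfl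
    simp only [mul_one] at h
    exact le_of_mul_le_mul_right (by linarith) (mul_pos hg1 hg1)
  have hK₁pos : 0 < K₁ := by linarith
  set L : ℝ := Real.log K₁ with hL
  set u : ℕ → ℝ := fun k => Real.log (g 1) - Real.log (g (2 ^ k)) with hu
  have hsup : ∀ j k, u j + u k ≤ u (j + k) + L := by
    intro j k
    have h := hK₁ (2 ^ j) (2 ^ k) Nat.one_le_two_pow Nat.one_le_two_pow
    rw [← pow_add] at h
    have hp1 := g_pos (2 ^ j)
    have hp2 := g_pos (2 ^ k)
    have hp3 := g_pos (2 ^ (j + k))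
    have hlog := Real.log_le_log (mul_pos hp3 hg1) h
    rw [Real.log_mul hp3.ne' hg1.ne', Real.log_mul hK₁pos.ne' (mul_pos hp1 hp2).ne',
      Real.log_mul hp1.ne' hp2.ne'] at hlog
    simp only [hu, hL]
    linarith
  -- `w := L - u` is subadditive and `w n / n` is bounded below (Simon–Lieb floor)
  set w : ℕ → ℝ := fun k => L - u k with hw
  have hwsub : Subadditive w := by
    intro m n
    simp only [hw]
    linarith [hsup m n]
  obtain ⟨c₀, hc₀, hfloor⟩ := g_floor
  have hhi : ∀ k : ℕ, u k ≤ (2 * Real.log 2) * k + (Real.log (g 1) - Real.log c₀) := by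
    intro k
    have h := hfloor (2 ^ k) Nat.one_le_two_pow
    have h2k : (0 : ℝ) < (2 : ℝ) ^ k := by positivity
    have hrp : (((2 ^ k : ℕ) : ℝ)) ^ (-(2 : ℝ)) = Real.exp (-(2 * Real.log 2 * k)) := by
      push_cast
      rw [Real.rpow_def_of_pos h2k, Real.log_pow]
      congr 1
      ring
    rw [hrp] at h
    have hlog := Real.log_le_log (mul_pos hc₀ (Real.exp_pos _)) h
    rw [Real.log_mul hc₀.ne' (Real.exp_pos _).ne', Real.log_exp] at hlog
    simp only [hu]
    linarith
  have hwbdd : BddBelow (Set.range fun n => w n / n) := by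
    set A : ℝ := Real.log (g 1) - Real.log c₀ with hA
    refine ⟨min 0 (-(2 * Real.log 2) - |A - L|), ?_⟩
    rintro _ ⟨n, rfl⟩
    rcases Nat.eq_zero_or_pos n with h0 | hpos
    · subst h0
      simp
    · have hn : (1 : ℝ) ≤ n := by exact_mod_cast hpos
      have hnpos : (0 : ℝ) < n := by linarith
      show min 0 (-(2 * Real.log 2) - |A - L|) ≤ w n / n
      rw [le_div_iff₀ hnpos]
      have habs := le_abs_self (A - L)
      have habs0 := abs_nonneg (A - L)
      calc min 0 (-(2 * Real.log 2) - |A - L|) * n ≤ (-(2 * Real.log 2) - |A - L|) * n :=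
            mul_le_mul_of_nonneg_right (min_le_right _ _) hnpos.le
        _ = -(2 * Real.log 2) * n - |A - L| * n := by ring
        _ ≤ -(2 * Real.log 2) * n - |A - L| := by nlinarith
        _ ≤ w n := by simp only [hw]; linarith [hhi n]
  have hwlim := hwsub.tendsto_lim hwbdd
  refine ⟨-hwsub.lim, L, ?_, fun k => ?_⟩
  · -- `u k / k = L/k - w k / k → 0 - lim`
    have h1 : Tendsto (fun k : ℕ => L / k - w k / k) atTop (𝓝 (0 - hwsub.lim)) :=
      (tendsto_const_div_atTop_nhds_zero_nat L).sub hwlim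
    rw [zero_sub] at h1
    refine h1.congr' ?_
    filter_upwards [eventually_ge_atTop 1] with k hk
    simp only [hw, hu]
    rw [← sub_div]
    congr 1
    ring
  · rcases Nat.eq_zero_or_pos k with h0 | hpos
    · subst h0
      have h2 := hsup 0 0
      simp only [add_zero] at h2
      simp only [hu] at h2 ⊢
      simp at h2 ⊢
      linarith
    · have hk : (0 : ℝ) < k := by exact_mod_cast hpos
      have hk0 : k ≠ 0 := by omega
      have h2 := hwsub.lim_le_div hwbdd hk0
      simp only [hw] at h2
      rw [le_div_iff₀ hk] at h2
      simp only [hu] at h2 ⊢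
      linarith

/-- **QM⁻ alone ⟹ upper envelope + existence of the dyadic exponent.** -/
theorem upper_envelope_of_scaleSupermult (h : ScaleSupermult) :
    ∃ σ L : ℝ, Tendsto (fun k : ℕ => (Real.log (g 1) - Real.log (g (2 ^ k))) / k) atTop (𝓝 σ) ∧
      ∀ k : ℕ, σ * k - L ≤ Real.log (g 1) - Real.log (g (2 ^ k)) := by
  obtain ⟨K₂, hK₂⟩ := h
  have hg1 := g_pos 1
  have hK₂1 : 1 ≤ K₂ := by
    have h := hK₂ 1 1 le_rfl le_rfl
    simp only [mul_one] at h
    exact le_of_mul_le_mul_right (by linarith) (mul_pos hg1 hg1)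
  have hK₂pos : 0 < K₂ := by linarith
  set L : ℝ := Real.log K₂ with hL
  set u : ℕ → ℝ := fun k => Real.log (g 1) - Real.log (g (2 ^ k)) with hu
  have hsub : ∀ j k, u (j + k) ≤ u j + u k + L := by
    intro j k
    have h := hK₂ (2 ^ j) (2 ^ k) Nat.one_le_two_pow Nat.one_le_two_pow
    rw [← pow_add] at h
    have hp1 := g_pos (2 ^ j)
    have hp2 := g_pos (2 ^ k)
    have hp3 := g_pos (2 ^ (j + k))
    have hlog := Real.log_le_log (mul_pos hp1 hp2) h
    rw [Real.log_mul hp1.ne' hp2.ne', Real.log_mul hK₂pos.ne' (mul_pos hp3 hg1).ne',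
      Real.log_mul hp3.ne' hg1.ne'] at hlog
    simp only [hu, hL]
    linarith
  set v : ℕ → ℝ := fun k => u k + L with hv
  have hvsub : Subadditive v := by
    intro m n
    simp only [hv]
    linarith [hsub m n]
  have hvbdd : BddBelow (Set.range fun n => v n / n) := by
    refine ⟨min 0 (-|L + Real.log (g 1)|), ?_⟩
    rintro _ ⟨n, rfl⟩
    rcases Nat.eq_zero_or_pos n with h0 | hpos
    · subst h0
      simp
    · have hn : (1 : ℝ) ≤ n := by exact_mod_cast hpos
      have hnpos : (0 : ℝ) < n := by linarith
      show min 0 (-|L + Real.log (g 1)|) ≤ v n / n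
      rw [le_div_iff₀ hnpos]
      have hglog : Real.log (g (2 ^ n)) ≤ 0 := by
        have := Real.log_le_log (g_pos (2 ^ n)) (g_le_one (2 ^ n))
        rwa [Real.log_one] at this
      have habs := neg_abs_le (L + Real.log (g 1))
      have habs0 := abs_nonneg (L + Real.log (g 1))
      calc min 0 (-|L + Real.log (g 1)|) * n ≤ (-|L + Real.log (g 1)|) * n :=
            mul_le_mul_of_nonneg_right (min_le_right _ _) hnpos.le
        _ ≤ -|L + Real.log (g 1)| := by nlinarith
        _ ≤ v n := by simp only [hv, hu]; linarith
  have hvlim := hvsub.tendsto_lim hvbdd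
  refine ⟨hvsub.lim, L, ?_, fun k => ?_⟩
  · have h1 : Tendsto (fun k : ℕ => v k / k - L / k) atTop (𝓝 (hvsub.lim - 0)) :=
      hvlim.sub (tendsto_const_div_atTop_nhds_zero_nat L)
    rw [sub_zero] at h1
    refine h1.congr' ?_
    filter_upwards [eventually_ge_atTop 1] with k hk
    simp only [hv, hu]
    rw [← sub_div]
    congr 1
    ring
  · rcases Nat.eq_zero_or_pos k with h0 | hpos
    · subst h0
      have h2 := hsub 0 0
      simp only [add_zero] at h2
      simp only [hu] at h2 ⊢
      simp at h2 ⊢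
      linarith
    · have hk : (0 : ℝ) < k := by exact_mod_cast hpos
      have hk0 : k ≠ 0 := by omega
      have h2 := hvsub.lim_le_div hvbdd hk0
      simp only [hv] at h2
      rw [le_div_iff₀ hk] at h2
      simp only [hu] at h2 ⊢
      linarith

/-! ## S1 of the 0634 line (summable dyadic rate) ALONE implies the crux -/

/-- `|log (1 + e)| ≤ 2|e|` for `|e| ≤ 1/2`. [folklore] -/
theorem abs_log_one_add_le {e : ℝ} (he : |e| ≤ 1 / 2) : |Real.log (1 + e)| ≤ 2 * |e| := by
  have he' := abs_le.1 he
  have hpos : 0 < 1 + e := by linarith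
  rw [abs_le]
  constructor
  · have h1 := Real.one_sub_inv_le_log_of_pos hpos
    have h2 : -(2 * |e|) ≤ 1 - (1 + e)⁻¹ := by
      rw [show (1 : ℝ) - (1 + e)⁻¹ = e / (1 + e) by field_simp; ring]
      rcases le_total 0 e with h | h
      · have : 0 ≤ e / (1 + e) := div_nonneg h hpos.le
        linarith [abs_nonneg e]
      · rw [abs_of_nonpos h, le_div_iff₀ hpos]
        nlinarith
    linarith
  · have h1 := Real.log_le_sub_one_of_pos hpos
    linarith [le_abs_self e, abs_nonneg e]

theorem two_pow_rpow_neg (i : ℕ) (ω : ℝ) : ((2 : ℝ) ^ i) ^ (-ω) = ((2 : ℝ) ^ (-ω)) ^ i := by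
  rw [← Real.rpow_natCast ((2 : ℝ) ^ (-ω)) i, ← Real.rpow_mul (by norm_num : (0 : ℝ) ≤ 2),
    mul_comm, Real.rpow_mul (by norm_num : (0 : ℝ) ≤ 2), Real.rpow_natCast]

/-- **S1 ⟹ DyadicPinned**: a summable power rate in the dyadic law makes
`k ↦ log g(2^k) + 2Δ k log 2` a Cauchy — hence BOUNDED — sequence. (Convergence, the extra content of
S1 over the crux, is not even used beyond boundedness.) -/
theorem dyadicPinned_of_dyadicDiniLaw (h : DyadicDiniLaw) : DyadicPinned := by
  obtain ⟨Δ, ω, C, hω, hdini⟩ := h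
  set C' : ℝ := max C 0 with hC'
  have hC'0 : 0 ≤ C' := le_max_right _ _
  set ρ : ℝ := (2 : ℝ) ^ (-ω) with hρ
  have hρ0 : 0 < ρ := Real.rpow_pos_of_pos two_pos _
  have hρ1 : ρ < 1 := Real.rpow_lt_one_of_one_lt_of_neg one_lt_two (neg_neg_of_pos hω)
  -- the dyadic log-sequence and its increments
  set b : ℕ → ℝ := fun k => Real.log (g (2 ^ k)) + 2 * Δ * k * Real.log 2 with hb
  set e : ℕ → ℝ := fun k => g (2 ^ (k + 1)) * (4 : ℝ) ^ Δ / g (2 ^ k) - 1 with he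
  have hebound : ∀ k : ℕ, |e k| ≤ C' * ρ ^ k := by
    intro k
    have hd := hdini (2 ^ k) Nat.one_le_two_pow
    have e1 : (Pi.single 0 (((2 * 2 ^ k : ℕ)) : ℤ) : Site 3) = Pi.single 0 (((2 ^ (k + 1) : ℕ)) : ℤ) := by
      rw [pow_succ']
    rw [e1] at hd
    have e2 : (((2 ^ k : ℕ)) : ℝ) ^ (-ω) = ρ ^ k := by
      push_cast
      rw [hρ]
      exact two_pow_rpow_neg k ω
    rw [e2] at hd
    refine hd.trans ?_
    exact mul_le_mul_of_nonneg_right (le_max_left _ _) (pow_nonneg hρ0.le k)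
  have hincr : ∀ k : ℕ, b (k + 1) - b k = Real.log (1 + e k) := by
    intro k
    have hp0 := g_pos (2 ^ k)
    have hp1 := g_pos (2 ^ (k + 1))
    have h4 : (0 : ℝ) < (4 : ℝ) ^ Δ := Real.rpow_pos_of_pos (by norm_num) _
    have hlog4 : Real.log ((4 : ℝ) ^ Δ) = 2 * Δ * Real.log 2 := by
      rw [Real.log_rpow (by norm_num : (0 : ℝ) < 4), show (4 : ℝ) = 2 ^ 2 by norm_num, Real.log_pow]
      push_cast
      ring
    simp only [hb, he]
    rw [add_sub_cancel, Real.log_div (mul_pos hp1 h4).ne' hp0.ne', Real.log_mul hp1.ne' h4.ne', hlog4]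
    push_cast
    ring
  -- eventually `C' ρ^k ≤ 1/2`
  have hsmall : Tendsto (fun k : ℕ => C' * ρ ^ k) atTop (𝓝 0) := by
    simpa using (tendsto_pow_atTop_nhds_zero_of_lt_one hρ0.le hρ1).const_mul C'
  obtain ⟨k₀, hk₀⟩ := eventually_atTop.1 (hsmall.eventually (ge_mem_nhds (by norm_num : (0 : ℝ) < 1 / 2)))
  have hδ_large : ∀ k : ℕ, k₀ ≤ k → |b (k + 1) - b k| ≤ 2 * C' * ρ ^ k := by
    intro k hk
    rw [hincr k]
    have hle : |e k| ≤ 1 / 2 := (hebound k).trans (hk₀ k hk)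
    calc |Real.log (1 + e k)| ≤ 2 * |e k| := abs_log_one_add_le hle
      _ ≤ 2 * (C' * ρ ^ k) := by linarith [hebound k]
      _ = 2 * C' * ρ ^ k := by ring
  -- a geometric bound valid for ALL k (enlarge the constant by the finitely many early increments)
  set D : ℝ := 2 * C' + ∑ i ∈ Finset.range k₀, |b (i + 1) - b i| / ρ ^ i with hD
  have hDsum : 0 ≤ ∑ i ∈ Finset.range k₀, |b (i + 1) - b i| / ρ ^ i :=
    Finset.sum_nonneg fun i _ => div_nonneg (abs_nonneg _) (pow_nonneg hρ0.le i)
  have hDall : ∀ i : ℕ, |b (i + 1) - b i| ≤ D * ρ ^ i := by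
    intro i
    have hρi : 0 < ρ ^ i := pow_pos hρ0 i
    by_cases hi : k₀ ≤ i
    · calc |b (i + 1) - b i| ≤ 2 * C' * ρ ^ i := hδ_large i hi
        _ ≤ D * ρ ^ i := by
            apply mul_le_mul_of_nonneg_right _ hρi.le
            simp only [hD]
            linarith
    · push Not at hi
      have hmem : i ∈ Finset.range k₀ := Finset.mem_range.2 hi
      have hle : |b (i + 1) - b i| / ρ ^ i ≤ ∑ j ∈ Finset.range k₀, |b (j + 1) - b j| / ρ ^ j :=
        Finset.single_le_sum (f := fun j => |b (j + 1) - b j| / ρ ^ j)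
          (fun j _ => div_nonneg (abs_nonneg _) (pow_nonneg hρ0.le j)) hmem
      calc |b (i + 1) - b i| = (|b (i + 1) - b i| / ρ ^ i) * ρ ^ i := by
            field_simp
        _ ≤ (∑ j ∈ Finset.range k₀, |b (j + 1) - b j| / ρ ^ j) * ρ ^ i :=
            mul_le_mul_of_nonneg_right hle hρi.le
        _ ≤ D * ρ ^ i := by
            apply mul_le_mul_of_nonneg_right _ hρi.le
            simp only [hD]
            linarith
  have hdist : ∀ i : ℕ, dist (b i) (b (i + 1)) ≤ D * ρ ^ i := fun i => by
    rw [Real.dist_eq, abs_sub_comm]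
    exact hDall i
  have hcs := cauchySeq_of_le_geometric ρ D hρ1 hdist
  obtain ⟨w, hw⟩ := cauchySeq_tendsto_of_complete hcs
  obtain ⟨M, hM⟩ := hw.bddAbove_range
  obtain ⟨M', hM'⟩ := hw.bddBelow_range
  refine dyadicPinned_of_log_linear (s := 2 * Δ) (B₁ := M') (B₂ := M) fun k => ⟨?_, ?_⟩
  · have := hM' ⟨k, rfl⟩
    simpa [hb, mul_assoc] using this
  · have := hM ⟨k, rfl⟩
    simpa [hb, mul_assoc] using this

/-- **S1 ⟹ crux.** The load-bearing registered stub of the sibling crux 0634's line implies 4662. -/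
theorem dimensionPinned_of_dyadicDiniLaw (h : DyadicDiniLaw) : DimensionPinned :=
  dimensionPinned_of_axisPinned (axisPinned_of_dyadicPinned (dyadicPinned_of_dyadicDiniLaw h))

/-! ## Item 0634 (isotropic pure power law with a limit constant) implies the crux -/

theorem sqrt_sum_sq_axis (m : ℕ) :
    Real.sqrt (∑ i, (((Pi.single 0 ((m : ℕ) : ℤ) : Site 3) i : ℝ)) ^ 2) = m := by
  have hsum : (∑ i, (((Pi.single 0 ((m : ℕ) : ℤ) : Site 3) i : ℝ)) ^ 2) = (m : ℝ) ^ 2 := by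
    rw [Fin.sum_univ_three]
    simp
  rw [hsum, Real.sqrt_sq (Nat.cast_nonneg m)]

/-- **0634 ⟹ DyadicPinned** (restrict the cofinite limit to the dyadic axis points, take logs:
a convergent real sequence is bounded). -/
theorem dyadicPinned_of_rotInvPowerLaw (h : RotInvPowerLaw) : DyadicPinned := by
  obtain ⟨Δ, c, hc, hlim⟩ := h
  -- the dyadic axis embedding tends to `cofinite`
  set f : ℕ → Site 3 := fun k => Pi.single 0 (((2 ^ k : ℕ)) : ℤ) with hf
  have hfinj : Function.Injective f := by
    intro a b hab
    simp only [hf] at hab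
    have h1 : (((2 ^ a : ℕ)) : ℤ) = ((2 ^ b : ℕ) : ℤ) := Pi.single_injective _ hab
    have h2 : (2 ^ a : ℕ) = 2 ^ b := by exact_mod_cast h1
    exact Nat.pow_right_injective le_rfl h2
  have hft : Tendsto f atTop cofinite := by
    rw [← Nat.cofinite_eq_atTop]
    exact hfinj.tendsto_cofinite
  have h1 := hlim.comp hft
  -- rewrite the composed sequence as `g(2^k) * (2^k)^(2Δ)`
  have h2 : Tendsto (fun k : ℕ => g (2 ^ k) * ((2 : ℝ) ^ k) ^ (2 * Δ)) atTop (𝓝 c) := by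
    refine h1.congr fun k => ?_
    simp only [Function.comp_apply, hf, g_def]
    rw [sqrt_sum_sq_axis]
    push_cast
    rfl
  -- logs
  have h3 : Tendsto (fun k : ℕ => Real.log (g (2 ^ k) * ((2 : ℝ) ^ k) ^ (2 * Δ))) atTop (𝓝 (Real.log c)) :=
    h2.log hc.ne'
  have h4 : Tendsto (fun k : ℕ => Real.log (g (2 ^ k)) + 2 * Δ * k * Real.log 2) atTop (𝓝 (Real.log c)) := by
    refine h3.congr fun k => ?_
    have h2k : (0 : ℝ) < (2 : ℝ) ^ k := by positivity
    rw [Real.log_mul (g_pos _).ne' (Real.rpow_pos_of_pos h2k _).ne', Real.log_rpow h2k, Real.log_pow]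
    ring
  obtain ⟨M, hM⟩ := h4.bddAbove_range
  obtain ⟨M', hM'⟩ := h4.bddBelow_range
  exact dyadicPinned_of_log_linear (s := 2 * Δ) (B₁ := M') (B₂ := M) fun k =>
    ⟨by simpa [mul_assoc] using hM' ⟨k, rfl⟩, by simpa [mul_assoc] using hM ⟨k, rfl⟩⟩

/-- **0634 ⟹ crux.** -/
theorem dimensionPinned_of_rotInvPowerLaw (h : RotInvPowerLaw) : DimensionPinned :=
  dimensionPinned_of_axisPinned (axisPinned_of_dyadicPinned (dyadicPinned_of_rotInvPowerLaw h))

/-! ## Consequences of the crux: items 6150 (doubling) and 0635 (η exists) -/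

/-- **crux ⟹ TwoPointDoubling (item 6150, verbatim).** -/
theorem twoPointDoubling_of_dimensionPinned (h : DimensionPinned) : TwoPointDoubling := by
  obtain ⟨s, c, C, hc, hb⟩ := axisPinned_of_dimensionPinned h
  have hcC : c ≤ C := by
    have h1 := hb 1 le_rfl
    simp at h1
    linarith [h1.1, h1.2]
  have hC : 0 < C := lt_of_lt_of_le hc hcC
  refine ⟨c * (2 : ℝ) ^ (-s) / C, by positivity, fun n hn => ?_⟩
  have hnpos : (0 : ℝ) < n := by exact_mod_cast (show 0 < n by omega)
  have h1 := (hb n hn).2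
  have h2 := (hb (2 * n) (by omega)).1
  have e1 : (Pi.single 0 (2 * (n : ℤ)) : Site 3) = Pi.single 0 (((2 * n : ℕ)) : ℤ) := by
    push_cast
    rfl
  rw [e1]
  have e2 : (((2 * n : ℕ)) : ℝ) ^ (-s) = (2 : ℝ) ^ (-s) * (n : ℝ) ^ (-s) := by
    push_cast
    rw [Real.mul_rpow (by norm_num) hnpos.le]
  rw [e2] at h2
  -- `κ g(n) ≤ κ/… ` : `g n ≤ C n^{-s}` so `n^{-s} ≥ g n / C`
  have h3 : g n / C ≤ (n : ℝ) ^ (-s) := by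
    rw [div_le_iff₀ hC]
    linarith
  calc c * (2 : ℝ) ^ (-s) / C * criticalTwoPoint 3 (Pi.single 0 (n : ℤ))
        = c * (2 : ℝ) ^ (-s) * (g n / C) := by rw [g_def]; ring
    _ ≤ c * (2 : ℝ) ^ (-s) * (n : ℝ) ^ (-s) := by
        apply mul_le_mul_of_nonneg_left h3
        positivity
    _ = c * ((2 : ℝ) ^ (-s) * (n : ℝ) ^ (-s)) := by ring
    _ ≤ g (2 * n) := h2
    _ = criticalTwoPoint 3 (Pi.single 0 (((2 * n : ℕ)) : ℤ)) := rfl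

/-- **crux ⟹ EtaExists (item 0635, verbatim)**, by the tree theorem
`HasIsingEtaBounds.hasIsingExponentEta'`. -/
theorem etaExists_of_dimensionPinned (h : DimensionPinned) : EtaExists := by
  obtain ⟨η, hη⟩ := h
  exact ⟨η, HasIsingEtaBounds.hasIsingExponentEta' hη⟩

/-! ## Each QM half alone already closes item 0635 (`η` exists) -/

/-- Axis decay exponent ⟹ `η` in the tree's (cofinite, logarithmic) sense, `η = L − 1`: the Step (3)–(4)
chain of `PointwiseScalingLimitEtaExists` (reading at `3m`, MMS sphere sandwich, `‖y‖∞ → ∞`), extracted.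
[cite: DuminilCopin2019, eq. (4.10)] -/
theorem hasIsingExponentEta_of_hasDecayExponent_axis {L : ℝ} (hax : HasDecayExponent g L) :
    HasIsingExponentEta 3 (L - 1) := by
  have hax3 := hax.comp_three_mul
  unfold HasDecayExponent at hax hax3
  have hn : Tendsto (fun y : Site 3 => Site.supNorm y) cofinite atTop := by
    have h := Site.tendsto_norm_cofinite_atTop (d := 3)
    simp_rw [Site.norm_eq_supNorm] at h
    exact tendsto_natCast_atTop_iff.1 h
  have hUp := hax.comp hn
  have hLo := hax3.comp hn
  have key : Tendsto (fun y : Site 3 => Real.log (criticalTwoPoint 3 y) / Real.log ‖y‖) cofinite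
      (𝓝 (-L)) := by
    refine tendsto_of_tendsto_of_tendsto_of_le_of_le' hLo hUp ?_ ?_
    · filter_upwards [hn.eventually (eventually_gt_atTop 1)] with y hy
      obtain ⟨hlo, -⟩ := criticalTwoPoint_axis_sandwich hy.le
      have hlog : 0 < Real.log ((Site.supNorm y : ℕ) : ℝ) := Real.log_pos (by exact_mod_cast hy)
      simp only [Function.comp_apply]
      rw [Site.norm_eq_supNorm]
      exact div_le_div_of_nonneg_right (Real.log_le_log (g_pos _) hlo) hlog.le
    · filter_upwards [hn.eventually (eventually_gt_atTop 1)] with y hy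
      obtain ⟨hlo, hup⟩ := criticalTwoPoint_axis_sandwich hy.le
      have hlog : 0 < Real.log ((Site.supNorm y : ℕ) : ℝ) := Real.log_pos (by exact_mod_cast hy)
      have hpos : 0 < criticalTwoPoint 3 y := (g_pos _).trans_le hlo
      simp only [Function.comp_apply]
      rw [Site.norm_eq_supNorm]
      exact div_le_div_of_nonneg_right (Real.log_le_log hpos hup) hlog.le
  unfold HasIsingExponentEta HasSpatialDecayExponent
  convert key using 2
  push_cast
  ring

/-- A dyadic rate `(log g 1 − log g(2^k))/k → σ` gives `η = σ/log 2 − 1` (antitone fill-in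
`HasDecayExponent.of_dyadic_of_antitone` + the previous theorem). -/
theorem etaExists_of_dyadic_rate {σ : ℝ}
    (h : Tendsto (fun k : ℕ => (Real.log (g 1) - Real.log (g (2 ^ k))) / k) atTop (𝓝 σ)) :
    EtaExists := by
  have hlog2 : Real.log 2 ≠ 0 := (Real.log_pos one_lt_two).ne'
  have h1 : Tendsto (fun k : ℕ => Real.log (g 1) / k - (Real.log (g 1) - Real.log (g (2 ^ k))) / k)
      atTop (𝓝 (0 - σ)) :=
    (tendsto_const_div_atTop_nhds_zero_nat (Real.log (g 1))).sub h
  have h2 : Tendsto (fun k : ℕ => Real.log (g (2 ^ k)) / k) atTop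
      (𝓝 (-(σ / Real.log 2) * Real.log 2)) := by
    have e : -(σ / Real.log 2) * Real.log 2 = 0 - σ := by field_simp; ring
    rw [e]
    refine h1.congr' ?_
    filter_upwards [eventually_ge_atTop 1] with k hk
    rw [← sub_div]
    congr 1
    ring
  have hax := HasDecayExponent.of_dyadic_of_antitone g_pos g_antitone h2
  exact ⟨σ / Real.log 2 - 1, hasIsingExponentEta_of_hasDecayExponent_axis hax⟩

/-- **QM⁺ alone ⟹ item 0635.** -/
theorem etaExists_of_scaleSubmult (h : ScaleSubmult) : EtaExists := by
  obtain ⟨σ, L, hlim, -⟩ := lower_envelope_of_scaleSubmult h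
  exact etaExists_of_dyadic_rate hlim

/-- **QM⁻ alone ⟹ item 0635.** -/
theorem etaExists_of_scaleSupermult (h : ScaleSupermult) : EtaExists := by
  obtain ⟨σ, L, hlim, -⟩ := upper_envelope_of_scaleSupermult h
  exact etaExists_of_dyadic_rate hlim

end Summit.CriticalPhenomena.Ising3DConformalLimit.Cruxes.DimensionPinned.CensusWeb
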